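import Summits.KontsevichZagierPeriods.KontsevichZagierPeriods.Theorems.PlanarCompiler.Negative.GreenTightness
import Literature.NumberTheory.Transcendental.SemialgebraicMapsProofs

/-!
# `PlanarCompiler` (stmt-KontsevichZagierPeriods-10058) — negative side VIII: no single twist restores injectivity

Refuter `cdisprove` (gen 2, cycle 2). The headline of the card `twist-restoring-shear` — "add `λab` to
the Green potential: the two Lagrangian projections `(a, A + λb)`, `(b, B + λa)` become monotone-twist
EMBEDDINGS of the open triangle, so the Green generator compiles to ONE change of variables (no
subdivision)" — is FALSE for the Green generator AS TYPED in the crux (coefficients continuous and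
ℚ-semialgebraic on the closed triangle, a `C¹` potential inside): `not_twistRestoresInjectivity`.
Datum (triage T3b, mechanised): the cusp potential `S = (b − a)·√|b − a|` with
`A = ∂_aS = −(3/2)√|b − a|`, `B = ∂_bS = (3/2)√|b − a|` — a typed Green datum
(`hasFDerivAt_cuspS` everywhere, `isSemialgebraicFunOn_cuspA/B`, continuity) whose twist
`∂_bA = −(3/4)·sgn(b−a)/√|b−a|` is unbounded of BOTH signs at the diagonal; on the vertical fibre
`a = 1/4` the map `b ↦ A + λb` has a `∧`-shaped cusp at `b = 1/4` that beats every linear term, so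
for EVERY real `λ` two distinct points of the open triangle have the same image under
`(a, A + λb)` (`exists_ne_cuspFibre_eq`, intermediate value theorem on both sides of the cusp). Bounded
twist (`A, B` Nash up to the boundary) is exactly when one `λ` works; the lead's reshaped line
(`λ = 0` + sign-CAD, `Lines/twist-restoring-shear.lean`) does not rely on the headline, and this
file is the formal reason it must not be re-introduced without a rectilinearisation step.
[Kontsevich–Zagier 2001, §1.2; Arnold 1989, §48; McDuff–Salamon 2017, Lemma 8.3.1]
-/

noncomputable section

open MeasureTheory Set MvPolynomial Filter Topology
open Literature.NumberTheory.Transcendental Literature.ModelTheory.ExponentialFields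

namespace Summit.KontsevichZagierPeriods.SymplecticScissors.PlanarCompilerNegative

/-! ## §8.0 The cusp profile `φ(x) = x·√|x|` is `C¹` with `φ′(x) = (3/2)√|x|` -/

/-- `φ(x) = x √|x| = sgn(x)|x|^{3/2}`. [folklore] -/
def cuspPhi (x : ℝ) : ℝ := x * Real.sqrt |x|

/-- `φ′(x) = (3/2)√|x|` for every real `x` (including the cusp `x = 0`, where `φ′(0) = 0`). [folklore] -/
theorem hasDerivAt_cuspPhi (x : ℝ) : HasDerivAt cuspPhi (3 / 2 * Real.sqrt |x|) x := by
  rcases lt_trichotomy x 0 with hx | rfl | hx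
  · -- left of the cusp: `φ(y) = y √(−y)`
    have hne : -x ≠ 0 := by linarith
    have h1 : HasDerivAt (fun y : ℝ => Real.sqrt (-y)) (1 / (2 * Real.sqrt (-x)) * (-1)) x :=
      (Real.hasDerivAt_sqrt hne).comp x (hasDerivAt_neg x)
    have h2 := (hasDerivAt_id x).mul h1
    have heq : cuspPhi =ᶠ[𝓝 x] fun y => id y * Real.sqrt (-y) := by
      filter_upwards [eventually_lt_nhds hx] with y hy
      simp [cuspPhi, abs_of_neg hy]
    refine (h2.congr_of_eventuallyEq heq).congr_deriv ?_
    have hs : 0 < Real.sqrt (-x) := Real.sqrt_pos.mpr (by linarith)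
    have hsq : Real.sqrt (-x) ^ 2 = -x := Real.sq_sqrt (by linarith)
    rw [abs_of_neg hx]
    simp only [id]
    field_simp
    linarith [hsq]
  · -- at the cusp: `|φ(h)| = |h|^{3/2} = o(h)`
    simp only [abs_zero, Real.sqrt_zero, mul_zero]
    rw [hasDerivAt_iff_isLittleO_nhds_zero]
    simp only [cuspPhi, zero_add, abs_zero, Real.sqrt_zero, mul_zero, sub_zero, smul_zero]
    refine Asymptotics.isLittleO_iff.mpr fun ε hε => ?_
    have hev : ∀ᶠ h in 𝓝 (0 : ℝ), |h| < ε ^ 2 := by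
      have h0 : Tendsto (fun h : ℝ => |h|) (𝓝 0) (𝓝 0) := by
        simpa using (continuous_abs.tendsto (0 : ℝ))
      exact h0.eventually (eventually_lt_nhds (by positivity))
    filter_upwards [hev] with h hh
    rw [Real.norm_eq_abs, Real.norm_eq_abs, abs_mul, abs_of_nonneg (Real.sqrt_nonneg _)]
    have hs : Real.sqrt |h| ≤ ε := by
      calc Real.sqrt |h| ≤ Real.sqrt (ε ^ 2) := Real.sqrt_le_sqrt hh.le
        _ = ε := Real.sqrt_sq hε.le
    calc |h| * Real.sqrt |h| ≤ |h| * ε := mul_le_mul_of_nonneg_left hs (abs_nonneg h)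
      _ = ε * |h| := mul_comm _ _
  · -- right of the cusp: `φ(y) = y √y`
    have h1 : HasDerivAt (fun y : ℝ => Real.sqrt y) (1 / (2 * Real.sqrt x)) x := Real.hasDerivAt_sqrt hx.ne'
    have h2 := (hasDerivAt_id x).mul h1
    have heq : cuspPhi =ᶠ[𝓝 x] fun y => id y * Real.sqrt y := by
      filter_upwards [eventually_gt_nhds hx] with y hy
      simp [cuspPhi, abs_of_pos hy]
    refine (h2.congr_of_eventuallyEq heq).congr_deriv ?_
    have hs : 0 < Real.sqrt x := Real.sqrt_pos.mpr hx
    have hsq : Real.sqrt x ^ 2 = x := Real.sq_sqrt hx.le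
    rw [abs_of_pos hx]
    simp only [id]
    field_simp
    linarith [hsq]

/-- `φ` is continuous. [folklore] -/
theorem continuous_cuspPhi : Continuous cuspPhi := by unfold cuspPhi; fun_prop

/-! ## §8.1 The cusp Green datum `S = φ(b − a)` -/

/-- `S = (b − a)√|b − a|`. [folklore] -/
def cuspS : (Fin 2 → ℝ) → ℝ := fun p => cuspPhi (p 1 - p 0)
/-- `A = ∂_aS = −(3/2)√|b − a|`. [folklore] -/
def cuspA : (Fin 2 → ℝ) → ℝ := fun p => -(3 / 2 * Real.sqrt |p 1 - p 0|)
/-- `B = ∂_bS = (3/2)√|b − a|`. [folklore] -/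
def cuspB : (Fin 2 → ℝ) → ℝ := fun p => 3 / 2 * Real.sqrt |p 1 - p 0|

/-- `dS = A da + B db` at EVERY point of the plane (so in particular on the open triangle). [folklore] -/
theorem hasFDerivAt_cuspS (p : Fin 2 → ℝ) :
    HasFDerivAt cuspS (cuspA p • ContinuousLinearMap.proj (R := ℝ) (φ := fun _ : Fin 2 => ℝ) 0 +
      cuspB p • ContinuousLinearMap.proj (R := ℝ) (φ := fun _ : Fin 2 => ℝ) 1) p := by
  have hd : HasFDerivAt (fun q : Fin 2 → ℝ => q 1 - q 0)
      (ContinuousLinearMap.proj (R := ℝ) (φ := fun _ : Fin 2 => ℝ) 1 -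
        ContinuousLinearMap.proj (R := ℝ) (φ := fun _ : Fin 2 => ℝ) 0) p :=
    (hasFDerivAt_apply 1 p).sub (hasFDerivAt_apply 0 p)
  have h := (hasDerivAt_cuspPhi (p 1 - p 0)).comp_hasFDerivAt p hd
  refine h.congr_fderiv ?_
  ext v
  simp [cuspA, cuspB]
  ring

/-- `A` is continuous. [folklore] -/
theorem continuous_cuspA : Continuous cuspA := by unfold cuspA; fun_prop
/-- `B` is continuous. [folklore] -/
theorem continuous_cuspB : Continuous cuspB := by unfold cuspB; fun_prop

/-- `B = (3/2)√|b − a|` is a ℚ-semialgebraic function on the closed triangle (`|·|`, `√·` and products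
of semialgebraic functions are semialgebraic — tree facts). [BCR 1998, Prop. 2.2.6] -/
theorem isSemialgebraicFunOn_cuspB : IsSemialgebraicFunOn ℚ triangle cuspB := by
  have h1 : IsSemialgebraicFunOn ℚ triangle (fun p : Fin 2 → ℝ => p 1 - p 0) :=
    (isSemialgebraicFunOn_aeval isSemialgebraic_triangle (X 1 - X 0)).congr fun p _ => by simp
  have h2 : IsSemialgebraicFunOn ℚ triangle (fun p : Fin 2 → ℝ => Real.sqrt |p 1 - p 0|) :=
    IsSemialgebraicFunOn.sqrt_holds h1.abs
  have h3 : IsSemialgebraicFunOn ℚ triangle (fun _ : Fin 2 → ℝ => (3 / 2 : ℝ)) :=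
    (isSemialgebraicFunOn_aeval isSemialgebraic_triangle (C (3 / 2))).congr fun p _ => by simp
  exact (IsSemialgebraicFunOn.mul_holds h3 h2).congr fun p _ => by simp [cuspB]

/-- `A = −B` is a ℚ-semialgebraic function on the closed triangle. [BCR 1998, Prop. 2.2.6] -/
theorem isSemialgebraicFunOn_cuspA : IsSemialgebraicFunOn ℚ triangle cuspA :=
  isSemialgebraicFunOn_cuspB.neg.congr fun p _ => by simp [cuspA, cuspB]

/-! ## §8.2 On the fibre `a = 1/4`, `b ↦ A + λb` is never injective -/

/-- The sheared fibre map at `a = 1/4`: `F_λ(b) = −(3/2)√|b − 1/4| + λ b`. [folklore] -/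
def cuspFibre (lam b : ℝ) : ℝ := -(3 / 2 * Real.sqrt |b - 1 / 4|) + lam * b

/-- `F_λ` is continuous. [folklore] -/
theorem continuous_cuspFibre (lam : ℝ) : Continuous (cuspFibre lam) := by unfold cuspFibre; fun_prop

/-- The cusp beats every linear term: for `t = min(1/8, 1/(λ²+1))`, `|λ|·t < (3/2)√t`. [folklore] -/
theorem cusp_beats_linear (lam : ℝ) :
    let t := min (1 / 8 : ℝ) (1 / (lam ^ 2 + 1))
    0 < t ∧ t ≤ 1 / 8 ∧ |lam| * t < 3 / 2 * Real.sqrt t := by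
  intro t
  have hl : 0 < lam ^ 2 + 1 := by positivity
  have ht0 : 0 < t := lt_min (by norm_num) (by positivity)
  have ht8 : t ≤ 1 / 8 := min_le_left _ _
  have htl : t ≤ 1 / (lam ^ 2 + 1) := min_le_right _ _
  refine ⟨ht0, ht8, ?_⟩
  have hs : 0 < Real.sqrt t := Real.sqrt_pos.mpr ht0
  have hsq : Real.sqrt t ^ 2 = t := Real.sq_sqrt ht0.le
  -- `lam² t ≤ lam²/(lam²+1) < 1 < 9/4`, hence `(|lam| √t)² < (3/2)²`
  have h1 : lam ^ 2 * t < 9 / 4 := by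
    have : lam ^ 2 * t ≤ lam ^ 2 * (1 / (lam ^ 2 + 1)) := mul_le_mul_of_nonneg_left htl (sq_nonneg _)
    have h2 : lam ^ 2 * (1 / (lam ^ 2 + 1)) < 1 := by
      rw [mul_one_div, div_lt_one hl]; linarith
    linarith
  have h2 : |lam| * Real.sqrt t < 3 / 2 := by
    have habs : 0 ≤ |lam| * Real.sqrt t := by positivity
    nlinarith [sq_abs lam, hsq, habs]
  calc |lam| * t = |lam| * Real.sqrt t * Real.sqrt t := by rw [mul_assoc, ← pow_two, hsq]
    _ < 3 / 2 * Real.sqrt t := mul_lt_mul_of_pos_right h2 hs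

/-- TWO DISTINCT POINTS, ONE IMAGE: for every real `λ` there are `b₁ ≠ b₂` in `(0, 3/4)` (the open
fibre of the triangle over `a = 1/4`) with `F_λ(b₁) = F_λ(b₂)` (IVT on both sides of the cusp). [folklore] -/
theorem exists_ne_cuspFibre_eq (lam : ℝ) :
    ∃ b₁ b₂ : ℝ, b₁ ≠ b₂ ∧ b₁ ∈ Ioo (0 : ℝ) (3 / 4) ∧ b₂ ∈ Ioo (0 : ℝ) (3 / 4) ∧
      cuspFibre lam b₁ = cuspFibre lam b₂ := by
  obtain ⟨ht0, ht8, hbeat⟩ := cusp_beats_linear lam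
  set t := min (1 / 8 : ℝ) (1 / (lam ^ 2 + 1)) with ht
  set F := cuspFibre lam with hF
  have hc : Continuous F := continuous_cuspFibre lam
  have hmid : F (1 / 4) = lam * (1 / 4) := by simp [hF, cuspFibre]
  have hleft : F (1 / 4 - t) < F (1 / 4) := by
    have h : F (1 / 4 - t) = -(3 / 2 * Real.sqrt t) + lam * (1 / 4 - t) := by
      simp only [hF, cuspFibre]
      rw [show (1 / 4 - t - 1 / 4 : ℝ) = -t by ring, abs_neg, abs_of_pos ht0]
    rw [h, hmid]
    nlinarith [neg_abs_le lam, hbeat, ht0]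
  have hright : F (1 / 4 + t) < F (1 / 4) := by
    have h : F (1 / 4 + t) = -(3 / 2 * Real.sqrt t) + lam * (1 / 4 + t) := by
      simp only [hF, cuspFibre]
      rw [show (1 / 4 + t - 1 / 4 : ℝ) = t by ring, abs_of_pos ht0]
    rw [h, hmid]
    nlinarith [le_abs_self lam, hbeat, ht0]
  set y := max (F (1 / 4 - t)) (F (1 / 4 + t)) with hy
  have hy_lt : y < F (1 / 4) := max_lt hleft hright
  obtain ⟨b₁, hb₁, hFb₁⟩ : y ∈ F '' Icc (1 / 4 - t) (1 / 4) :=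
    intermediate_value_Icc (by linarith) hc.continuousOn ⟨le_max_left _ _, hy_lt.le⟩
  obtain ⟨b₂, hb₂, hFb₂⟩ : y ∈ F '' Icc (1 / 4) (1 / 4 + t) :=
    intermediate_value_Icc' (by linarith) hc.continuousOn ⟨le_max_right _ _, hy_lt.le⟩
  refine ⟨b₁, b₂, ?_, ⟨by linarith [hb₁.1], by linarith [hb₁.2]⟩,
    ⟨by linarith [hb₂.1], by linarith [hb₂.2]⟩, by rw [hFb₁, hFb₂]⟩
  rintro rfl
  have hb : b₁ = 1 / 4 := le_antisymm hb₁.2 hb₂.1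
  rw [hb] at hFb₁
  exact (lt_irrefl _) (hFb₁ ▸ hy_lt)

/-! ## §8.3 The refuted headline -/

/-- "Twist restoration": for every Green datum as typed in the crux there is a rational `λ` making
BOTH sheared Lagrangian projections `(a, A + λb)` and `(b, B + λa)` injective on the open triangle
(so that the Green generator would be ONE change-of-variables instance, with no subdivision). -/
def TwistRestoresInjectivity : Prop :=
  ∀ (A B S : (Fin 2 → ℝ) → ℝ),
    IsSemialgebraicFunOn ℚ {p : Fin 2 → ℝ | 0 ≤ p 0 ∧ 0 ≤ p 1 ∧ p 0 + p 1 ≤ 1} A →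
    IsSemialgebraicFunOn ℚ {p : Fin 2 → ℝ | 0 ≤ p 0 ∧ 0 ≤ p 1 ∧ p 0 + p 1 ≤ 1} B →
    ContinuousOn A {p : Fin 2 → ℝ | 0 ≤ p 0 ∧ 0 ≤ p 1 ∧ p 0 + p 1 ≤ 1} →
    ContinuousOn B {p : Fin 2 → ℝ | 0 ≤ p 0 ∧ 0 ≤ p 1 ∧ p 0 + p 1 ≤ 1} →
    (∀ p : Fin 2 → ℝ, 0 < p 0 → 0 < p 1 → p 0 + p 1 < 1 →
      HasFDerivAt S (A p • ContinuousLinearMap.proj (R := ℝ) (φ := fun _ : Fin 2 => ℝ) 0 +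
        B p • ContinuousLinearMap.proj (R := ℝ) (φ := fun _ : Fin 2 => ℝ) 1) p) →
    ∃ lam : ℚ, Set.InjOn (fun p : Fin 2 → ℝ => (![p 0, A p + (lam : ℝ) * p 1] : Fin 2 → ℝ))
        {p : Fin 2 → ℝ | 0 < p 0 ∧ 0 < p 1 ∧ p 0 + p 1 < 1} ∧
      Set.InjOn (fun p : Fin 2 → ℝ => (![p 1, B p + (lam : ℝ) * p 0] : Fin 2 → ℝ))
        {p : Fin 2 → ℝ | 0 < p 0 ∧ 0 < p 1 ∧ p 0 + p 1 < 1}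

/-- NO SINGLE TWIST: `TwistRestoresInjectivity` is FALSE — for the cusp datum `S = (b−a)√|b−a|`
and EVERY `λ`, the vertical sweep `(a, A + λb)` identifies two distinct points of the fibre `a = 1/4`.
So "one λ, no subdivision" needs bounded twist (e.g. `A, B` Nash up to the boundary); for the Green
generator as typed, a subdivision / rectilinearisation step is unavoidable. [folklore] -/
theorem not_twistRestoresInjectivity : ¬ TwistRestoresInjectivity := by
  intro H
  obtain ⟨lam, hinj, -⟩ := H cuspA cuspB cuspS isSemialgebraicFunOn_cuspA isSemialgebraicFunOn_cuspB
    continuous_cuspA.continuousOn continuous_cuspB.continuousOn (fun p _ _ _ => hasFDerivAt_cuspS p)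
  obtain ⟨b₁, b₂, hne, hb₁, hb₂, hF⟩ := exists_ne_cuspFibre_eq lam
  have hmem : ∀ b ∈ Ioo (0 : ℝ) (3 / 4),
      (![1 / 4, b] : Fin 2 → ℝ) ∈ {p : Fin 2 → ℝ | 0 < p 0 ∧ 0 < p 1 ∧ p 0 + p 1 < 1} := by
    intro b hb
    simp only [mem_setOf_eq, Matrix.cons_val_zero, Matrix.cons_val_one]
    exact ⟨by norm_num, hb.1, by linarith [hb.2]⟩
  have key : ∀ b : ℝ, (fun p : Fin 2 → ℝ => (![p 0, cuspA p + (lam : ℝ) * p 1] : Fin 2 → ℝ)) ![1 / 4, b] =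
      ![1 / 4, cuspFibre lam b] := by
    intro b; ext i; fin_cases i <;> simp [cuspA, cuspFibre]
  have himg : (fun p : Fin 2 → ℝ => (![p 0, cuspA p + (lam : ℝ) * p 1] : Fin 2 → ℝ)) ![1 / 4, b₁] =
      (fun p : Fin 2 → ℝ => (![p 0, cuspA p + (lam : ℝ) * p 1] : Fin 2 → ℝ)) ![1 / 4, b₂] := by
    rw [key, key, hF]
  have heq := hinj (hmem b₁ hb₁) (hmem b₂ hb₂) himg
  have h1 := congr_fun heq 1
  simp at h1
  exact hne h1

end Summit.KontsevichZagierPeriods.SymplecticScissors.PlanarCompilerNegative
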